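import Summits.Ventures.WeilGRH.ZetaWindowAtoms
import Summits.Ventures.WeilGRH.ZetaGramAtoms
import Summits.Ventures.WeilGRH.WindowBudgetGoldstonGonek
import HarnessLib

/-!
# rh-explicit (venture WeilGRH): under RH — ONE WINDOW BOUNDS EVERY MULTIPLICITY, with every constant
  elementary: `2a·ord_{s=½+iτ}ζ ≤ pole + log(1+|τ|) + 3 − log π + 5/a + 8a·e^a`, hence
  `ord ≤ (½+o(1)) log|τ|/log log|τ|` (Goldston–Gonek 2007) from Weil positivity

Cell `rh-explicit`, WEIL TRACK (structure seat weil-3, gen10).  RH corollaries of `ZetaWindowAtoms.lean` that need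
only that file, `WindowBudgetGoldstonGonek.lean` and gen9's `ZetaGramAtoms.zetaZeroHeightMeasure_singleton_of_riemannHypothesis` (`ν_ζ{τ} = ord`):

* `modulatedZetaFlatWindow_le_of_riemannHypothesis` (the modulated `ζ` flat-window inequality at every window);
* **`two_mul_mul_zetaZeroOrder_le_budget`**: RH ⟹ `2a·ord_{s=½+iτ}ζ ≤ 4(sinh²(a/2)+sin²(aτ))/(a(¼+τ²)) − K₀ +
  [Re ψ(¼+iτ/2) − Re ψ(¼)] + 5/a + 2Σ_{log n<2a}Λ(n)n^{-1/2}(1 − log n/(2a))` for every `a > 0`, `τ`;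
* (`flatBudget_le`, `archConstants_le_log` and the pure-analysis step `goldstonGonek_of_window_budget` are
  `WindowBudgetGoldstonGonek.lean`, which also carries the `L(s, χ)` twin under GRH);
* **`two_mul_mul_zetaZeroOrder_le_explicit`**: RH ⟹
  `2a·ord_{s=½+iτ}ζ ≤ 4(sinh²(a/2)+sin²(aτ))/(a(¼+τ²)) + log(1+|τ|) + 3 − log π + 5/a + 8a·e^a`;
* **`zetaZeroOrder_le_goldstonGonek_of_riemannHypothesis`**: RH ⟹ for every `ε > 0`, eventually in `τ`,
  `ord_{s=½+iτ}ζ ≤ (½ + ε)·log τ/log log τ` — Goldston–Gonek 2007's bound, shape AND constant, from Weil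
  positivity one window at a time (`a = log L − 2log log L`, `L = log(1+τ)`; the `½` is the archimedean weight
  `log τ` divided by the longest window at which the crude prime budget `8a·e^a` stays subdominant).

No definitions, no named facts; RH is a hypothesis of every theorem.

## References

* D. A. Goldston, S. M. Gonek, *A note on S(t) and the zeros of the Riemann zeta-function*, Bull. London
  Math. Soc. 39 (2007) 482–486, Theorem 1/Corollary (`m(γ) ≤ (½+o(1)) log γ/log log γ` on RH). [GoldstonGonek2007]
-/

set_option autoImplicit false

noncomputable section

open Complex Filter Set MeasureTheory
open scoped Real Topology ComplexConjugate ArithmeticFunction.vonMangoldt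

namespace Summit.Ventures.WeilGRH

open Literature.NumberTheory.LFunctions
open Literature.NumberTheory.LFunctions.Yoshida1992 (chi)
open Literature.NumberTheory.LFunctions.WeilBochner (zetaZeroHeightMeasure)
open Literature.Analysis.SpecialFunctions (reDigammaQuarter)
open Summit.RiemannHypothesis.RiemannHypothesis.Theorems.WeilFormatC

variable {a : ℝ}

/-! ## The modulated inequality and the budget under RH -/

/-- **Under RH, the modulated `ζ` flat-window inequality at every window and every height** (`ZetaWindowAtoms.modulatedZetaFlatWindow_le_of_weilPositivityOn`). -/
theorem modulatedZetaFlatWindow_le_of_riemannHypothesis (hRH : RiemannHypothesis) (ha : 0 < a) (θ : ℝ) :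
    2 * (∑ n ∈ weilPrimeIndex a, (Λ n : ℝ) / Real.sqrt n *
          ((1 - Real.log n / (2 * a)) * Real.cos (θ * Real.log n))) +
        (Real.log (4 * π) + Real.eulerMascheroniConstant +
          2 * ∫ t in Ioi (0 : ℝ), (Real.exp (t / 2) - 1) / (2 * Real.sinh t)) -
        ∫ t in Ioi (0 : ℝ), weilArchDensity t *
          (2 * (1 - Real.cos (θ * t)) + Real.cos (θ * t) * (min t (2 * a) / a)) ≤
      weilPoleForm (fun x ↦ cexp (I * (θ * x : ℝ)) * chi a 0 x) :=
  modulatedZetaFlatWindow_le_of_weilPositivityOn ha (riemannHypothesis_iff_forall_weilPositivityOn.1 hRH a ha) θ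

/-- **RH ⟹ ONE WINDOW BOUNDS EVERY MULTIPLICITY (budget form).**  If the Riemann hypothesis holds then for
every `a > 0` and every `τ ∈ ℝ`

  `2a · ord_{s=½+iτ} ζ(s) ≤ 4(sinh²(a/2) + sin²(aτ))/(a(¼+τ²)) − K₀ + [Re ψ(¼+iτ/2) − Re ψ(¼)] + 5/a`
      `+ 2Σ_{log n<2a} Λ(n)n^{-1/2}(1 − log n/(2a))`

(`K₀ = log 4π + γ + 2∫₀^∞(e^{t/2}−1)dt/(2 sinh t) = 2ζ′(½)/ζ(½)`).  With `2Σ_{n<e^{2a}}Λ(n)n^{-1/2} ≍ 4e^a/a`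
and `a ≍ log log|τ|` this is `ord ≤ (½+o(1)) log|τ|/log log|τ|`; at each fixed `a ≤ 4023/5000` the same
inequality holds for every `ζ`-window measure unconditionally (`two_mul_mul_zetaAtom_le_budget`). -/
theorem two_mul_mul_zetaZeroOrder_le_budget (hRH : RiemannHypothesis) (ha : 0 < a) (τ : ℝ) :
    2 * a * ((riemannZetaZeroOrder (1 / 2 + τ * I)).toNat : ℝ) ≤
      4 * (Real.sinh (a / 2) ^ 2 + Real.sin (τ * a) ^ 2) / (a * (1 / 4 + τ ^ 2)) -
        (Real.log (4 * π) + Real.eulerMascheroniConstant +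
          2 * ∫ t in Ioi (0 : ℝ), (Real.exp (t / 2) - 1) / (2 * Real.sinh t)) +
        (reDigammaQuarter τ - reDigammaQuarter 0) + 5 / a +
        2 * (∑ n ∈ weilPrimeIndex a, (Λ n : ℝ) / Real.sqrt n * (1 - Real.log n / (2 * a))) := by
  have h := two_mul_mul_zetaAtom_le_budget ha
    (fun _ hg _ ↦ WeilBochner.weilQuadratic_eq_integral_of_riemannHypothesis hRH hg) τ
  rwa [measureReal_def, zetaZeroHeightMeasure_singleton_of_riemannHypothesis hRH, ENNReal.toReal_natCast] at h

/-! ## The budget made elementary -/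

/-- **RH ⟹ AN ELEMENTARY EXPLICIT MULTIPLICITY BOUND.**  For every `a > 0` and `τ ∈ ℝ`:

  `2a · ord_{s=½+iτ} ζ(s) ≤ 4(sinh²(a/2) + sin²(aτ))/(a(¼+τ²)) + log(1+|τ|) + 3 − log π + 5/a + 8a·e^a`.

With `L = log(1+|τ|)` and `e^a = L/(log L)²` the right side is `L(1 + 8/log L) + O(1)` while `2a = 2log L − 4log log L`:
`ord ≤ (½ + o(1))·log|τ|/log log|τ|` — the Goldston–Gonek 2007 shape AND constant, from Weil positivity one
window at a time, with every constant elementary. -/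
theorem two_mul_mul_zetaZeroOrder_le_explicit (hRH : RiemannHypothesis) (ha : 0 < a) (τ : ℝ) :
    2 * a * ((riemannZetaZeroOrder (1 / 2 + τ * I)).toNat : ℝ) ≤
      4 * (Real.sinh (a / 2) ^ 2 + Real.sin (τ * a) ^ 2) / (a * (1 / 4 + τ ^ 2)) +
        (Real.log (1 + |τ|) + 3 - Real.log π) + 5 / a + 8 * a * Real.exp a := by
  have h := two_mul_mul_zetaZeroOrder_le_budget hRH ha τ
  have h1 := flatBudget_le ha
  have h2 := archConstants_le_log τ
  linarith

/-! ## Goldston–Gonek: `ord ≤ (½ + o(1)) log τ / log log τ` -/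

/-- **RH ⟹ THE GOLDSTON–GONEK MULTIPLICITY BOUND, shape AND constant, from Weil positivity**: for every
`ε > 0`, for all sufficiently large `τ`,

  `ord_{s=½+iτ} ζ(s) ≤ (½ + ε) · log τ / log log τ`

(`two_mul_mul_zetaZeroOrder_le_explicit` fed to `goldstonGonek_of_window_budget`: at the window
`a = log L − 2 log log L`, `L = log τ`, the pole term is `≤ 8`, `log(1+τ) ≤ L + 1`, `5/a ≤ 5`, the prime budget
`8a·e^a ≤ 8L/log L` is subdominant, and `2a = 2 log L − 4 log log L ~ 2 log log τ`). -/
theorem zetaZeroOrder_le_goldstonGonek_of_riemannHypothesis (hRH : RiemannHypothesis) {ε : ℝ} (hε : 0 < ε) :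
    ∀ᶠ τ : ℝ in atTop, ((riemannZetaZeroOrder (1 / 2 + τ * I)).toNat : ℝ) ≤
      (1 / 2 + ε) * Real.log τ / Real.log (Real.log τ) := by
  refine goldstonGonek_of_window_budget (m := fun τ ↦ ((riemannZetaZeroOrder (1 / 2 + τ * I)).toNat : ℝ))
    (C := 3 - Real.log π)
    (P := fun a τ ↦ 4 * (Real.sinh (a / 2) ^ 2 + Real.sin (τ * a) ^ 2) / (a * (1 / 4 + τ ^ 2)))
    (fun _ ↦ by positivity) (fun a τ ha1 hτ1 hea ↦ ?_)
    (fun a τ ha ↦ by have := two_mul_mul_zetaZeroOrder_le_explicit hRH ha τ; linarith) hε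
  -- the pole term is at most `8` once `1 ≤ a`, `1 ≤ τ`, `e^a ≤ τ`
  have hsinh : Real.sinh (a / 2) ^ 2 ≤ Real.exp a := by
    have hs0 : 0 ≤ Real.sinh (a / 2) := Real.sinh_nonneg_iff.2 (by linarith)
    have hs1 : Real.sinh (a / 2) ≤ Real.exp (a / 2) := by
      rw [Real.sinh_eq]
      have := Real.exp_pos (-(a / 2))
      have := Real.exp_pos (a / 2)
      linarith
    calc Real.sinh (a / 2) ^ 2 ≤ Real.exp (a / 2) ^ 2 := pow_le_pow_left₀ hs0 hs1 2
      _ = Real.exp a := by rw [sq, ← Real.exp_add]; ring_nf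
  show 4 * (Real.sinh (a / 2) ^ 2 + Real.sin (τ * a) ^ 2) / (a * (1 / 4 + τ ^ 2)) ≤ 8
  rw [div_le_iff₀ (by positivity)]
  have hsin : Real.sin (τ * a) ^ 2 ≤ Real.exp a :=
    (Real.sin_sq_le_one (τ * a)).trans (Real.one_le_exp (by linarith))
  have hq : Real.exp a ≤ a * (1 / 4 + τ ^ 2) :=
    calc Real.exp a ≤ τ := hea
      _ ≤ 1 * (1 / 4 + τ ^ 2) := by nlinarith [sq_nonneg (τ - 1 / 2)]
      _ ≤ a * (1 / 4 + τ ^ 2) := mul_le_mul_of_nonneg_right ha1 (by positivity)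
  calc 4 * (Real.sinh (a / 2) ^ 2 + Real.sin (τ * a) ^ 2) ≤ 4 * (Real.exp a + Real.exp a) := by gcongr
    _ = 8 * Real.exp a := by ring
    _ ≤ 8 * (a * (1 / 4 + τ ^ 2)) := by linarith

end Summit.Ventures.WeilGRH

end
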